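import Summits.Ventures.Crystal3D.Theorems.StickyWulffConstantGenericWallFloorDozenStep
import Summits.Ventures.Crystal3D.Theorems.StickyWulffConstantGenericWallFloorSlotFrameIdentity
import HarnessLib

/-!
# An in-plane slot is a difference of two near-polar slots (slot algebra for the lines floor)

HONEST FRAMING. Venture `Summits/Ventures/Crystal3D` (cell `crystal3d-full`), helper for the crux
`GenericWallFloor` (stmt-Ventures-19480) of `route-Ventures-StickyWulffConstant`, REGISTERED line `WallLedgerG`,
open stub `stub_twoSlabAdhesion` (general fillings; lines floor, memo LINES-FLOOR-ARCH v3 = evidence #54).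
Rung credit only; F-C1 not moved.  Pure slot algebra, no packing statement:

* `inPlane_eq_sub_of_nearPolar` — `n` a unit `{111}` normal of the frame `A` (menu `⟪A w, n⟫ ∈ {0, ±√(2/3)}`),
  `w₁, w₂, w₃` the three near-polar slots (`⟪A wᵢ, n⟫ = −√(2/3)`), `u` a slot with `⟪A u, n⟫ = 0`: then
  `u = a − b` for two of the `wᵢ`.  Proof: the values `⟪u, wᵢ⟫ ∈ {½, 0, −½}` sum to `0`
  (`A w₁ + A w₂ + A w₃ = −√6 n`, `sum_eq_sqrt_six_smul`) and are not all `0` — otherwise `u` is orthogonal to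
  both polar triples and the slot frame identity `Σ_w ⟪w, u⟫² = 4` (`sum_slots_inner_sq`) would be carried by
  the six in-plane slots, which carry at most `1 + 1 + 4·¼ = 3`; a `+½` and a `−½` give `‖u − (a − b)‖ = 0`.
Used by `…GenericWallFloorLineRise` (every step of a slot line rises by `1/9`).
WHAT THIS IS NOT: not the stub; F-C1 not moved.
-/

noncomputable section

namespace Summit.Ventures.Crystal3D.Theorems

open Summit.Ventures.Crystal3D Finset
open Literature.MathematicalPhysics.StatisticalMechanics (fccStacking)
open scoped InnerProductSpace


/-! ### In-plane slots are differences of near-polar slots -/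

/-- Unit vectors with `⟪u, a⟫ = 1/2`, `⟪u, b⟫ = −1/2`, `⟪a, b⟫ = 1/2` satisfy `u = a − b`. -/
theorem eq_sub_of_inner_half {u a b : EuclideanSpace ℝ (Fin 3)} (hu : ‖u‖ = 1) (ha : ‖a‖ = 1)
    (hb : ‖b‖ = 1) (hab : ⟪a, b⟫_ℝ = 1 / 2) (hua : ⟪u, a⟫_ℝ = 1 / 2) (hub : ⟪u, b⟫_ℝ = -(1 / 2)) :
    u = a - b := by
  have h0 : ‖u - (a - b)‖ ^ 2 = 0 := by
    rw [norm_sub_sq_real, norm_sub_sq_real, inner_sub_right, hu, ha, hb, hab, hua, hub]; ring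
  rw [sq_eq_zero_iff, norm_eq_zero, sub_eq_zero] at h0
  exact h0

/-- Three numbers in `{1/2, 0, −1/2}` with sum `0`, not all `0`, contain a `+1/2` and a `−1/2`. -/
theorem exists_half_and_neg_half {c₁ c₂ c₃ : ℝ}
    (h₁ : c₁ = 1 / 2 ∨ c₁ = 0 ∨ c₁ = -(1 / 2)) (h₂ : c₂ = 1 / 2 ∨ c₂ = 0 ∨ c₂ = -(1 / 2))
    (h₃ : c₃ = 1 / 2 ∨ c₃ = 0 ∨ c₃ = -(1 / 2)) (hsum : c₁ + c₂ + c₃ = 0) (hne : ¬ (c₁ = 0 ∧ c₂ = 0 ∧ c₃ = 0)) :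
    (c₁ = 1 / 2 ∧ c₂ = -(1 / 2)) ∨ (c₁ = 1 / 2 ∧ c₃ = -(1 / 2)) ∨ (c₂ = 1 / 2 ∧ c₁ = -(1 / 2)) ∨
      (c₂ = 1 / 2 ∧ c₃ = -(1 / 2)) ∨ (c₃ = 1 / 2 ∧ c₁ = -(1 / 2)) ∨ (c₃ = 1 / 2 ∧ c₂ = -(1 / 2)) := by
  rcases h₁ with rfl | rfl | rfl <;> rcases h₂ with rfl | rfl | rfl <;> rcases h₃ with rfl | rfl | rfl <;>
    first
    | (exfalso; norm_num at hsum; done)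
    | exact absurd ⟨rfl, rfl, rfl⟩ hne
    | norm_num

/-- **An in-plane slot is a difference of two near-polar slots.**  `n` a unit `{111}` normal of the frame
`A` (menu `⟪A w, n⟫ ∈ {0, ±√(2/3)}`), `w₁, w₂, w₃` the three near-polar slots (`⟪A wᵢ, n⟫ = −√(2/3)`,
distinct), `u` a slot with `⟪A u, n⟫ = 0`.  Then `u = a − b` for two of the `wᵢ`. -/
theorem inPlane_eq_sub_of_nearPolar
    (A : EuclideanSpace ℝ (Fin 3) ≃ₗᵢ[ℝ] EuclideanSpace ℝ (Fin 3)) {n u w₁ w₂ w₃ : EuclideanSpace ℝ (Fin 3)}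
    (hn : ‖n‖ = 1)
    (hmenu : ∀ w ∈ fccSlots, ⟪A w, n⟫_ℝ = 0 ∨ ⟪A w, n⟫_ℝ = Real.sqrt (2 / 3) ∨ ⟪A w, n⟫_ℝ = -Real.sqrt (2 / 3))
    (hu : u ∈ fccSlots) (hun : ⟪A u, n⟫_ℝ = 0)
    (hw₁ : w₁ ∈ fccSlots) (hw₂ : w₂ ∈ fccSlots) (hw₃ : w₃ ∈ fccSlots)
    (h12 : w₁ ≠ w₂) (h13 : w₁ ≠ w₃) (h23 : w₂ ≠ w₃)
    (hn₁ : ⟪A w₁, n⟫_ℝ = -Real.sqrt (2 / 3)) (hn₂ : ⟪A w₂, n⟫_ℝ = -Real.sqrt (2 / 3))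
    (hn₃ : ⟪A w₃, n⟫_ℝ = -Real.sqrt (2 / 3)) :
    ∃ a ∈ ({w₁, w₂, w₃} : Finset (EuclideanSpace ℝ (Fin 3))),
      ∃ b ∈ ({w₁, w₂, w₃} : Finset (EuclideanSpace ℝ (Fin 3))), u = a - b := by
  classical
  have hrpos : 0 < Real.sqrt (2 / 3) := Real.sqrt_pos.2 (by norm_num)
  have hu1 := norm_eq_one_of_mem_fccSlots hu
  have slotA : ∀ {w}, w ∈ fccSlots → A w ∈ A '' fccStacking 1 (Real.sqrt (2 / 3)) ∧ ‖A w‖ = 1 :=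
    fun hw => ⟨⟨_, mem_fcc_of_mem_fccSlots hw, rfl⟩,
      by rw [LinearIsometryEquiv.norm_map, norm_eq_one_of_mem_fccSlots hw]⟩
  -- the values `cᵢ = ⟪u, wᵢ⟫ ∈ {1/2, 0, −1/2}`
  have hval : ∀ {w}, w ∈ fccSlots → ⟪A w, n⟫_ℝ = -Real.sqrt (2 / 3) →
      ⟪u, w⟫_ℝ = 1 / 2 ∨ ⟪u, w⟫_ℝ = 0 ∨ ⟪u, w⟫_ℝ = -(1 / 2) := by
    intro w hw hwn
    have hw1 := norm_eq_one_of_mem_fccSlots hw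
    have h := inner_mem_of_unit_slots A (slotA hu).1 (slotA hw).1 (slotA hu).2 (slotA hw).2
    rw [LinearIsometryEquiv.inner_map_map] at h
    rcases h with h | h | h | h | h
    · exfalso
      have : ‖u - w‖ ^ 2 = 0 := by rw [norm_sub_sq_real, hu1, hw1, h]; ring
      rw [sq_eq_zero_iff, norm_eq_zero, sub_eq_zero] at this
      rw [this, hwn] at hun; linarith
    · exact Or.inl h
    · exact Or.inr (Or.inl h)
    · exact Or.inr (Or.inr h)
    · exfalso
      have : ‖u + w‖ ^ 2 = 0 := by rw [norm_add_sq_real, hu1, hw1, h]; ring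
      rw [sq_eq_zero_iff, norm_eq_zero] at this
      have hu' : u = -w := eq_neg_of_add_eq_zero_left this
      rw [hu', map_neg, inner_neg_left, hwn, neg_neg] at hun; linarith
  -- the sum `c₁ + c₂ + c₃ = 0`
  have hpair : ∀ {a b}, a ∈ fccSlots → b ∈ fccSlots → a ≠ b → ⟪A a, n⟫_ℝ = -Real.sqrt (2 / 3) →
      ⟪A b, n⟫_ℝ = -Real.sqrt (2 / 3) → ⟪a, b⟫_ℝ = 1 / 2 := by
    intro a b ha hb hab han hbn
    have h := inner_eq_half_of_far_slots A (n := -n) (slotA ha).1 (slotA hb).1 (slotA ha).2 (slotA hb).2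
      (by rw [norm_neg, hn]) (by rw [inner_neg_right, han, neg_neg]) (by rw [inner_neg_right, hbn, neg_neg])
      (fun e => hab (A.injective e))
    rwa [LinearIsometryEquiv.inner_map_map] at h
  have hsumvec : A w₁ + A w₂ + A w₃ = Real.sqrt 6 • (-n) :=
    sum_eq_sqrt_six_smul (A w₁) (A w₂) (A w₃) (-n) (slotA hw₁).2 (slotA hw₂).2 (slotA hw₃).2
      (by rw [norm_neg, hn])
      (by rw [LinearIsometryEquiv.inner_map_map]; exact hpair hw₁ hw₂ h12 hn₁ hn₂)
      (by rw [LinearIsometryEquiv.inner_map_map]; exact hpair hw₁ hw₃ h13 hn₁ hn₃)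
      (by rw [LinearIsometryEquiv.inner_map_map]; exact hpair hw₂ hw₃ h23 hn₂ hn₃)
      (by rw [inner_neg_right, hn₁, neg_neg]) (by rw [inner_neg_right, hn₂, neg_neg])
      (by rw [inner_neg_right, hn₃, neg_neg])
  have hsum : ⟪u, w₁⟫_ℝ + ⟪u, w₂⟫_ℝ + ⟪u, w₃⟫_ℝ = 0 := by
    have h : ⟪A u, A w₁ + A w₂ + A w₃⟫_ℝ = 0 := by
      rw [hsumvec, inner_smul_right, inner_neg_right, hun]; ring
    rw [inner_add_right, inner_add_right, LinearIsometryEquiv.inner_map_map, LinearIsometryEquiv.inner_map_map,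
      LinearIsometryEquiv.inner_map_map] at h
    exact h
  -- not all `cᵢ` vanish: the slot frame identity
  have hne : ¬ (⟪u, w₁⟫_ℝ = 0 ∧ ⟪u, w₂⟫_ℝ = 0 ∧ ⟪u, w₃⟫_ℝ = 0) := by
    rintro ⟨c₁, c₂, c₃⟩
    -- the near-polar slots are exactly `w₁, w₂, w₃`
    have hN3 : (fccSlots.filter fun w => 0 < ⟪A w, -n⟫_ℝ).card = 3 :=
      card_far_slots_eq_three A (n := -n) (by rw [norm_neg, hn])
        (fun w hw => by
          rcases hmenu w hw with h | h | h
          · exact Or.inl (by rw [inner_neg_right, h, neg_zero])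
          · exact Or.inr (Or.inr (by rw [inner_neg_right, h]))
          · exact Or.inr (Or.inl (by rw [inner_neg_right, h, neg_neg])))
    have hNeq : (fccSlots.filter fun w => 0 < ⟪A w, -n⟫_ℝ) = {w₁, w₂, w₃} := by
      symm
      apply Finset.eq_of_subset_of_card_le
      · intro w hw
        simp only [Finset.mem_insert, Finset.mem_singleton] at hw
        rw [mem_filter]
        rcases hw with rfl | rfl | rfl
        · exact ⟨hw₁, by rw [inner_neg_right, hn₁, neg_neg]; exact hrpos⟩
        · exact ⟨hw₂, by rw [inner_neg_right, hn₂, neg_neg]; exact hrpos⟩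
        · exact ⟨hw₃, by rw [inner_neg_right, hn₃, neg_neg]; exact hrpos⟩
      · rw [hN3, Finset.card_insert_of_notMem, Finset.card_insert_of_notMem, Finset.card_singleton]
        · simpa using h23
        · simp [h12, h13]
    -- every slot off the plane is orthogonal to `u`
    have horth : ∀ w ∈ fccSlots, ⟪A w, n⟫_ℝ ≠ 0 → ⟪w, u⟫_ℝ = 0 := by
      intro w hw hw0
      have near : ∀ v ∈ fccSlots, ⟪A v, n⟫_ℝ = -Real.sqrt (2 / 3) → ⟪v, u⟫_ℝ = 0 := by
        intro v hv hvn
        have : v ∈ (fccSlots.filter fun w => 0 < ⟪A w, -n⟫_ℝ) :=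
          mem_filter.2 ⟨hv, by rw [inner_neg_right, hvn, neg_neg]; exact hrpos⟩
        rw [hNeq] at this
        simp only [Finset.mem_insert, Finset.mem_singleton] at this
        rcases this with rfl | rfl | rfl
        · rw [real_inner_comm]; exact c₁
        · rw [real_inner_comm]; exact c₂
        · rw [real_inner_comm]; exact c₃
      rcases hmenu w hw with h | h | h
      · exact absurd h hw0
      · have := near (-w) (neg_mem_fccSlots hw) (by rw [map_neg, inner_neg_left, h])
        rwa [inner_neg_left, neg_eq_zero] at this
      · exact near w hw h
    -- the frame identity: `4 = Σ_w ⟪w, u⟫² = Σ_{in-plane} ⟪w, u⟫² ≤ 3`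
    have hid := sum_slots_inner_sq u
    rw [hu1, one_pow, mul_one] at hid
    set Z := fccSlots.filter fun w => ⟪A w, n⟫_ℝ = 0 with hZ
    have hsplit := Finset.sum_filter_add_sum_filter_not fccSlots (fun w => ⟪A w, n⟫_ℝ = 0)
      (fun w => ⟪w, u⟫_ℝ ^ 2)
    have hoff : ∑ w ∈ fccSlots.filter (fun w => ¬ ⟪A w, n⟫_ℝ = 0), ⟪w, u⟫_ℝ ^ 2 = 0 := by
      apply Finset.sum_eq_zero
      intro w hw
      rw [mem_filter] at hw
      rw [horth w hw.1 hw.2]; ring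
    rw [hoff, add_zero, hid] at hsplit
    -- `card Z ≤ 6`
    have hP3 : (fccSlots.filter fun w => 0 < ⟪A w, n⟫_ℝ).card = 3 := card_far_slots_eq_three A hn hmenu
    have hcardZ : Z.card ≤ 6 := by
      have h1 := Finset.card_filter_add_card_filter_not (s := fccSlots) (fun w => ⟪A w, n⟫_ℝ = 0)
      rw [card_fccSlots] at h1
      have h2 : (fccSlots.filter fun w => 0 < ⟪A w, n⟫_ℝ) ∪ (fccSlots.filter fun w => 0 < ⟪A w, -n⟫_ℝ) ⊆
          fccSlots.filter fun w => ¬ ⟪A w, n⟫_ℝ = 0 := by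
        intro w hw
        rw [mem_filter]
        rcases mem_union.1 hw with hw | hw <;> rw [mem_filter] at hw
        · exact ⟨hw.1, hw.2.ne'⟩
        · refine ⟨hw.1, ?_⟩
          have := hw.2; rw [inner_neg_right] at this
          intro h0; rw [h0, neg_zero] at this; exact lt_irrefl 0 this
      have h3 : Disjoint (fccSlots.filter fun w => 0 < ⟪A w, n⟫_ℝ) (fccSlots.filter fun w => 0 < ⟪A w, -n⟫_ℝ) := by
        rw [Finset.disjoint_filter]
        intro w _ h1 h2
        rw [inner_neg_right] at h2; linarith
      have h4 := card_le_card h2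
      rw [card_union_of_disjoint h3, hP3, hN3] at h4
      rw [hZ]
      omega
    -- `u, −u ∈ Z` and the termwise bound `≤ 1/4` off `±u`
    have huZ : u ∈ Z := mem_filter.2 ⟨hu, hun⟩
    have hnuZ : -u ∈ Z := mem_filter.2 ⟨neg_mem_fccSlots hu, by rw [map_neg, inner_neg_left, hun, neg_zero]⟩
    have hune : -u ≠ u := by
      intro h
      have : (2 : ℝ) • u = 0 := by rw [two_smul]; nth_rewrite 1 [← h]; rw [neg_add_cancel]
      rw [smul_eq_zero] at this
      rcases this with h2 | h0
      · norm_num at h2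
      · rw [h0, norm_zero] at hu1; norm_num at hu1
    have hbound : ∀ w ∈ (Z.erase u).erase (-u), ⟪w, u⟫_ℝ ^ 2 ≤ 1 / 4 := by
      intro w hw
      have hw1 := Finset.mem_erase.1 hw
      have hw2 := Finset.mem_erase.1 hw1.2
      have hwZ := mem_filter.1 hw2.2
      have hws := hwZ.1
      have hw1' := norm_eq_one_of_mem_fccSlots hws
      have h := inner_mem_of_unit_slots A (slotA hws).1 (slotA hu).1 (slotA hws).2 (slotA hu).2
      rw [LinearIsometryEquiv.inner_map_map] at h
      rcases h with h | h | h | h | h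
      · exfalso
        have : ‖w - u‖ ^ 2 = 0 := by rw [norm_sub_sq_real, hu1, hw1', h]; ring
        rw [sq_eq_zero_iff, norm_eq_zero, sub_eq_zero] at this
        exact hw2.1 this
      · rw [h]; norm_num
      · rw [h]; norm_num
      · rw [h]; norm_num
      · exfalso
        have : ‖w + u‖ ^ 2 = 0 := by rw [norm_add_sq_real, hu1, hw1', h]; ring
        rw [sq_eq_zero_iff, norm_eq_zero] at this
        exact hw1.1 (eq_neg_of_add_eq_zero_left this)
    have hsumZ : ∑ w ∈ Z, ⟪w, u⟫_ℝ ^ 2 =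
        ⟪u, u⟫_ℝ ^ 2 + (⟪-u, u⟫_ℝ ^ 2 + ∑ w ∈ (Z.erase u).erase (-u), ⟪w, u⟫_ℝ ^ 2) := by
      rw [← Finset.add_sum_erase Z _ huZ, ← Finset.add_sum_erase (Z.erase u) _ (Finset.mem_erase.2 ⟨hune, hnuZ⟩)]
    have hcard' : ((Z.erase u).erase (-u)).card ≤ 4 := by
      rw [Finset.card_erase_of_mem (Finset.mem_erase.2 ⟨hune, hnuZ⟩), Finset.card_erase_of_mem huZ]
      omega
    have hle := Finset.sum_le_card_nsmul _ _ _ hbound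
    rw [nsmul_eq_mul] at hle
    have huu : ⟪u, u⟫_ℝ = 1 := by rw [real_inner_self_eq_norm_sq, hu1, one_pow]
    have hnuu : ⟪-u, u⟫_ℝ = -1 := by rw [inner_neg_left, huu]
    rw [hsumZ, huu, hnuu] at hsplit
    have : (((Z.erase u).erase (-u)).card : ℝ) ≤ 4 := by exact_mod_cast hcard'
    nlinarith
  -- finish
  have hw₁1 := norm_eq_one_of_mem_fccSlots hw₁
  have hw₂1 := norm_eq_one_of_mem_fccSlots hw₂
  have hw₃1 := norm_eq_one_of_mem_fccSlots hw₃
  have m1 : w₁ ∈ ({w₁, w₂, w₃} : Finset (EuclideanSpace ℝ (Fin 3))) := by simp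
  have m2 : w₂ ∈ ({w₁, w₂, w₃} : Finset (EuclideanSpace ℝ (Fin 3))) := by simp
  have m3 : w₃ ∈ ({w₁, w₂, w₃} : Finset (EuclideanSpace ℝ (Fin 3))) := by simp
  have p12 := hpair hw₁ hw₂ h12 hn₁ hn₂
  have p13 := hpair hw₁ hw₃ h13 hn₁ hn₃
  have p23 := hpair hw₂ hw₃ h23 hn₂ hn₃
  have p21 : ⟪w₂, w₁⟫_ℝ = 1 / 2 := by rw [real_inner_comm]; exact p12
  have p31 : ⟪w₃, w₁⟫_ℝ = 1 / 2 := by rw [real_inner_comm]; exact p13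
  have p32 : ⟪w₃, w₂⟫_ℝ = 1 / 2 := by rw [real_inner_comm]; exact p23
  rcases exists_half_and_neg_half (hval hw₁ hn₁) (hval hw₂ hn₂) (hval hw₃ hn₃) hsum hne with
    ⟨ha, hb⟩ | ⟨ha, hb⟩ | ⟨ha, hb⟩ | ⟨ha, hb⟩ | ⟨ha, hb⟩ | ⟨ha, hb⟩
  · exact ⟨w₁, m1, w₂, m2, eq_sub_of_inner_half hu1 hw₁1 hw₂1 p12 ha hb⟩
  · exact ⟨w₁, m1, w₃, m3, eq_sub_of_inner_half hu1 hw₁1 hw₃1 p13 ha hb⟩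
  · exact ⟨w₂, m2, w₁, m1, eq_sub_of_inner_half hu1 hw₂1 hw₁1 p21 ha hb⟩
  · exact ⟨w₂, m2, w₃, m3, eq_sub_of_inner_half hu1 hw₂1 hw₃1 p23 ha hb⟩
  · exact ⟨w₃, m3, w₁, m1, eq_sub_of_inner_half hu1 hw₃1 hw₁1 p31 ha hb⟩
  · exact ⟨w₃, m3, w₂, m2, eq_sub_of_inner_half hu1 hw₃1 hw₂1 p32 ha hb⟩

end Summit.Ventures.Crystal3D.Theorems

end
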